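import Literature.NumberTheory.LFunctions.NicolasJExplicit
import Literature.NumberTheory.LFunctions.TrivialZerosSimple
import HarnessLib

/-!
# The averaged square-root term `∫ₐ^X (ψ(√t) − √t) w₀(t) dt` under RH

Topic: `Literature/NumberTheory/LFunctions`. THEOREMS (everything proved, no definition, nothing
asserted). Provefact `Literature.NumberTheory.LFunctions.Nicolas2012_logf_lower_sharp` (Nicolas 2012,
display (2.18), `NicolasMertensRH.lean`).

In Nicolas's proof of (2.18) the integral `J(x) − K(x) = ∫ₓ^∞ (ψ(t) − θ(t)) w₀(t) dt`
(`w₀(t) = (1/log t + 1/log² t)/t²`, Cor. 2.1 (2.13)) is bounded through the POINTWISE Lemma 2.4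
(2.12), `ψ(t) − θ(t) ≤ √t + (4/3) t^{1/3}`, whose Case 2 (`2³² ≤ t < 64·10²²`) rests on a table of
`θ(y) < y` (`y ≤ 8·10¹¹`, Dusart; Platt–Trudgian in the tree, the named computation
`PlattTrudgian2016_theta_lt`) that the kernel cannot replay. The leading part of `ψ(t) − θ(t)` is
`θ(√t) ≤ ψ(√t) = √t + R(√t)`, `R = ψ − id`, and what (2.13) needs is only the AVERAGE of `R(√t)`
against the smooth weight `w₀`. Under RH that average is controlled by the explicit formula for
`ψ₁ = ∫ψ` (absolutely convergent, proved in the tree: `NicolasJExplicit.Rone_eq_explicit`,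
`norm_psiOne_zeroSum_le_of_RH`, and the monotone trivial-zero remainder,
`TrivialZerosSimple.re_psiOneRemainder_sub_mem`), with no `log² t` loss: integrating by parts with
`U(t) = R₁(√t)` (`R₁ = ψ₁ − t²/2`, right derivative `R(√t)/(2√t)`) and
`V(t) = 2√t w₀(t) = 2 wt(t) t^{−3/2}` (`wt = 1/log + 1/log²`,
`−V'(t) = (3/log t + 5/log² t + 4/log³ t) t^{−5/2} > 0`),

  `∫ₐ^X R(√t) w₀ = R₁(√X)V(X) − R₁(√a)V(a) + ∫ₐ^X R₁(√t)(−V'(t)) dt`   (`integral_R_sqrt_mul_w0_eq`),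

and `R₁(u) = −Re Z(u) − u log 2π + Re E(u)` with `|Z(u)| ≤ β u^{3/2}` (RH), `Re E` non-decreasing
with total increase `≤ u₀/(2(u₀² − 1))` after `u₀`, gives (`integral_R_sqrt_mul_w0_le`): under RH, for
`1 < a ≤ X`,

  `∫ₐ^X (ψ(√t) − √t) w₀(t) dt ≤ 2β wt(a) a^{−3/4} + (4/3) β h(a) a^{−3/4} + 2 log(2π) wt(a)/a`
  `                              + wt(a) a^{−1}/(a − 1) + 2β wt(a) X^{−3/4}`,

`h(a) = 3/log a + 5/log² a + 4/log³ a`. This is `O(a^{−3/4}/log a)`, against the `a^{−2/3}/log a` of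
room that (2.13) leaves, which is how the sibling `NicolasCor21RH.lean` proves Cor. 2.1 — and hence
(2.18) with Nicolas's printed constants — from RH without any `θ(y) < y` table. (This averaging
argument is ours; Nicolas's pointwise route needs the table exactly on `[2²², 2⁴⁰]`, where
Schoenfeld's `√y log² y/(8π)` exceeds the available slack.)

## References

* J.-L. Nicolas, *Small values of the Euler function and the Riemann hypothesis*, Acta Arith. 155
  (2012), 311–321 (arXiv:1202.0729): (1.15)–(1.17), Cor. 2.1 (2.13), Lemma 2.4 (2.12), Lemma 2.5,
  display (2.18). [Nicolas2012]
* H. L. Montgomery, R. C. Vaughan, *Multiplicative Number Theory I*, CUP 2007, §12.1.1 Ex. 6,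
  (13.7)–(13.8) (explicit formula for `ψ₁`). [MontgomeryVaughan2007]
-/

noncomputable section

open Filter Set MeasureTheory intervalIntegral
open scoped Real Chebyshev Topology

namespace Literature.NumberTheory.LFunctions

namespace NicolasSqrtAverage

open NicolasJ NicolasFz NicolasJExplicit

/-! ### Power bookkeeping -/

/-- `t⁻¹ · t^{−3/2} = t^{−5/2}` (`t > 0`). [folklore] -/
theorem inv_mul_rpow_neg_three_halves {t : ℝ} (ht : 0 < t) :
    t⁻¹ * t ^ (-(3 / 2) : ℝ) = t ^ (-(5 / 2) : ℝ) := by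
  rw [← Real.rpow_neg_one, ← Real.rpow_add ht]; norm_num

/-- `(√t)^{3/2} = t^{3/4}` (`t ≥ 0`). [folklore] -/
theorem sqrt_rpow_three_halves {t : ℝ} (ht : 0 ≤ t) :
    Real.sqrt t ^ (3 / 2 : ℝ) = t ^ (3 / 4 : ℝ) := by
  rw [Real.sqrt_eq_rpow, ← Real.rpow_mul ht]; norm_num

/-- `t^{3/4} · t^{−5/2} = t^{−7/4}` (`t > 0`). [folklore] -/
theorem rpow_three_quarters_mul {t : ℝ} (ht : 0 < t) :
    t ^ (3 / 4 : ℝ) * t ^ (-(5 / 2) : ℝ) = t ^ (-(7 / 4) : ℝ) := by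
  rw [← Real.rpow_add ht]; norm_num

/-- `a^{3/4} · a^{−3/2} = a^{−3/4}` (`a > 0`). [folklore] -/
theorem rpow_three_quarters_mul' {a : ℝ} (ha : 0 < a) :
    a ^ (3 / 4 : ℝ) * a ^ (-(3 / 2) : ℝ) = a ^ (-(3 / 4) : ℝ) := by
  rw [← Real.rpow_add ha]; norm_num

/-- `√a · a^{−3/2} = a⁻¹` (`a > 0`). [folklore] -/
theorem sqrt_mul_rpow_neg_three_halves {a : ℝ} (ha : 0 < a) :
    Real.sqrt a * a ^ (-(3 / 2) : ℝ) = a⁻¹ := by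
  rw [Real.sqrt_eq_rpow, ← Real.rpow_add ha, ← Real.rpow_neg_one]; norm_num

/-- `(1/(2√t)) · (2 wt(t) t^{−3/2}) = w₀(t)` (`t > 0`): the product `U'V` of the integration by parts is
Nicolas's integrand. [folklore] -/
theorem uv_eq_w0 {t : ℝ} (ht : 0 < t) :
    1 / (2 * Real.sqrt t) * (2 * wt t * t ^ (-(3 / 2) : ℝ)) = w0 t := by
  have hs : 0 < Real.sqrt t := Real.sqrt_pos.2 ht
  have h1 : t ^ (-(3 / 2) : ℝ) = Real.sqrt t * (t ^ 2)⁻¹ := by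
    rw [Real.sqrt_eq_rpow, ← Real.rpow_two, ← Real.rpow_neg ht.le, ← Real.rpow_add ht]; norm_num
  rw [h1, w0]
  field_simp

/-! ### The weight `V(t) = 2 wt(t) t^{−3/2}` and its derivative -/

/-- `wt'(t) = −(1/log² t + 2/log³ t)/t` for `t > 1`. [folklore] -/
theorem hasDerivAt_wt {t : ℝ} (ht : 1 < t) :
    HasDerivAt wt (-(1 / Real.log t ^ 2 + 2 / Real.log t ^ 3) * t⁻¹) t := by
  have ht0 : t ≠ 0 := by positivity
  have hlog : Real.log t ≠ 0 := (Real.log_pos ht).ne'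
  have hl := Real.hasDerivAt_log ht0
  have h1 : HasDerivAt (fun u : ℝ ↦ (Real.log u)⁻¹) (-(t⁻¹) / Real.log t ^ 2) t := hl.inv hlog
  have h2 : HasDerivAt (fun u : ℝ ↦ (Real.log u ^ 2)⁻¹)
      (-(((2 : ℕ) : ℝ) * Real.log t ^ (2 - 1) * t⁻¹) / (Real.log t ^ 2) ^ 2) t :=
    (hl.pow 2).inv (pow_ne_zero _ hlog)
  have hfun : wt = fun u : ℝ ↦ (Real.log u)⁻¹ + (Real.log u ^ 2)⁻¹ := by
    funext u; simp only [wt, one_div]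
  rw [hfun]
  refine (h1.add h2).congr_deriv ?_
  push_cast
  field_simp
  ring

/-- **`V'(t) = −h(t) t^{−5/2}`**, `h(t) = 3/log t + 5/log² t + 4/log³ t`, for the weight
`V(t) = 2 wt(t) t^{−3/2}` (`t > 1`). [folklore] -/
theorem hasDerivAt_V {t : ℝ} (ht : 1 < t) :
    HasDerivAt (fun u : ℝ ↦ 2 * wt u * u ^ (-(3 / 2) : ℝ))
      (-(3 / Real.log t + 5 / Real.log t ^ 2 + 4 / Real.log t ^ 3) * t ^ (-(5 / 2) : ℝ)) t := by
  have ht0 : 0 < t := by linarith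
  have h1 : HasDerivAt (fun u : ℝ ↦ 2 * wt u) (2 * (-(1 / Real.log t ^ 2 + 2 / Real.log t ^ 3) * t⁻¹)) t :=
    (hasDerivAt_wt ht).const_mul 2
  have h2 : HasDerivAt (fun u : ℝ ↦ u ^ (-(3 / 2) : ℝ)) (-(3 / 2) * t ^ (-(3 / 2) - 1 : ℝ)) t :=
    Real.hasDerivAt_rpow_const (Or.inl ht0.ne')
  refine (h1.mul h2).congr_deriv ?_
  have e1 : t ^ (-(3 / 2) - 1 : ℝ) = t ^ (-(5 / 2) : ℝ) := by norm_num
  rw [e1]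
  have key := inv_mul_rpow_neg_three_halves ht0
  simp only [wt]
  linear_combination (2 * (-(1 / Real.log t ^ 2 + 2 / Real.log t ^ 3))) * key

/-- `h(t) = 3/log t + 5/log² t + 4/log³ t` is positive for `t > 1`. [folklore] -/
theorem h_pos {t : ℝ} (ht : 1 < t) : 0 < 3 / Real.log t + 5 / Real.log t ^ 2 + 4 / Real.log t ^ 3 := by
  have : 0 < Real.log t := Real.log_pos ht
  positivity

/-- `h` is non-increasing on `(1, ∞)`: `h(t) ≤ h(a)` for `t ≥ a > 1`. [folklore] -/
theorem h_le {a t : ℝ} (ha : 1 < a) (hat : a ≤ t) :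
    3 / Real.log t + 5 / Real.log t ^ 2 + 4 / Real.log t ^ 3 ≤
      3 / Real.log a + 5 / Real.log a ^ 2 + 4 / Real.log a ^ 3 := by
  have hla : 0 < Real.log a := Real.log_pos ha
  have hlt : Real.log a ≤ Real.log t := Real.log_le_log (by linarith) hat
  refine add_le_add (add_le_add ?_ ?_) ?_
  · exact div_le_div_of_nonneg_left (by norm_num) hla hlt
  · exact div_le_div_of_nonneg_left (by norm_num) (by positivity) (pow_le_pow_left₀ hla.le hlt 2)
  · exact div_le_div_of_nonneg_left (by norm_num) (by positivity) (pow_le_pow_left₀ hla.le hlt 3)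

/-- `wt` is non-increasing on `(1, ∞)`. [folklore] -/
theorem wt_le {a t : ℝ} (ha : 1 < a) (hat : a ≤ t) : wt t ≤ wt a := by
  have hla : 0 < Real.log a := Real.log_pos ha
  have hlt : Real.log a ≤ Real.log t := Real.log_le_log (by linarith) hat
  unfold wt
  refine add_le_add ?_ ?_
  · exact one_div_le_one_div_of_le hla hlt
  · exact one_div_le_one_div_of_le (by positivity) (pow_le_pow_left₀ hla.le hlt 2)

/-- `h` is continuous on `[a, ∞)`, `a > 1`. [folklore] -/
theorem continuousOn_h {a : ℝ} (ha : 1 < a) :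
    ContinuousOn (fun t : ℝ ↦ 3 / Real.log t + 5 / Real.log t ^ 2 + 4 / Real.log t ^ 3) (Ici a) := by
  have hlog : ContinuousOn Real.log (Ici a) := Real.continuousOn_log.mono fun t ht ↦ by
    simp only [mem_compl_iff, mem_singleton_iff]; linarith [mem_Ici.1 ht]
  have hne : ∀ t ∈ Ici a, Real.log t ≠ 0 := fun t ht ↦ (Real.log_pos (ha.trans_le ht)).ne'
  refine ((continuousOn_const.div hlog hne).add (continuousOn_const.div (hlog.pow 2) fun t ht ↦
    pow_ne_zero _ (hne t ht))).add (continuousOn_const.div (hlog.pow 3) fun t ht ↦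
    pow_ne_zero _ (hne t ht))

/-- `V' = −h · t^{−5/2}` is continuous on `[a, ∞)`, `a > 1`. [folklore] -/
theorem continuousOn_V' {a : ℝ} (ha : 1 < a) :
    ContinuousOn (fun t : ℝ ↦ -(3 / Real.log t + 5 / Real.log t ^ 2 + 4 / Real.log t ^ 3) *
      t ^ (-(5 / 2) : ℝ)) (Ici a) := by
  refine (continuousOn_h ha).neg.mul ?_
  exact ContinuousOn.rpow_const continuousOn_id fun t ht ↦
    Or.inl (ne_of_gt (show (0 : ℝ) < t from lt_trans zero_lt_one (ha.trans_le (mem_Ici.1 ht))))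

/-- `V = 2 wt t^{−3/2}` is continuous on `[a, ∞)`, `a > 1`. [folklore] -/
theorem continuousOn_V {a : ℝ} (ha : 1 < a) :
    ContinuousOn (fun t : ℝ ↦ 2 * wt t * t ^ (-(3 / 2) : ℝ)) (Ici a) :=
  fun _ ht ↦ (hasDerivAt_V (ha.trans_le ht)).continuousAt.continuousWithinAt

/-- `∫ₐ^X h(t) t^{−5/2} dt = V(a) − V(X)` (`1 < a ≤ X`). [folklore] -/
theorem integral_negV' {a X : ℝ} (ha : 1 < a) (haX : a ≤ X) :
    ∫ t in a..X, (3 / Real.log t + 5 / Real.log t ^ 2 + 4 / Real.log t ^ 3) * t ^ (-(5 / 2) : ℝ) =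
      2 * wt a * a ^ (-(3 / 2) : ℝ) - 2 * wt X * X ^ (-(3 / 2) : ℝ) := by
  have hderiv : ∀ t ∈ uIcc a X, HasDerivAt (fun u : ℝ ↦ 2 * wt u * u ^ (-(3 / 2) : ℝ))
      (-(3 / Real.log t + 5 / Real.log t ^ 2 + 4 / Real.log t ^ 3) * t ^ (-(5 / 2) : ℝ)) t := by
    intro t ht
    rw [uIcc_of_le haX] at ht
    exact hasDerivAt_V (ha.trans_le ht.1)
  have hint : IntervalIntegrable (fun t : ℝ ↦ -(3 / Real.log t + 5 / Real.log t ^ 2 + 4 / Real.log t ^ 3) *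
      t ^ (-(5 / 2) : ℝ)) volume a X := by
    refine ContinuousOn.intervalIntegrable ?_
    rw [uIcc_of_le haX]
    exact (continuousOn_V' ha).mono Icc_subset_Ici_self
  have h := integral_eq_sub_of_hasDerivAt hderiv hint
  have h2 : ∫ t in a..X, (3 / Real.log t + 5 / Real.log t ^ 2 + 4 / Real.log t ^ 3) * t ^ (-(5 / 2) : ℝ) =
      -∫ t in a..X, -(3 / Real.log t + 5 / Real.log t ^ 2 + 4 / Real.log t ^ 3) * t ^ (-(5 / 2) : ℝ) := by
    rw [← intervalIntegral.integral_neg]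
    refine intervalIntegral.integral_congr fun t _ ↦ ?_
    ring
  rw [h2, h]
  ring

/-! ### Integration by parts for `∫ₐ^X (ψ(√t) − √t) w₀(t) dt` -/

/-- `t ↦ ψ(√t)` is monotone. [folklore] -/
theorem monotone_psi_sqrt : Monotone fun t : ℝ ↦ ψ (Real.sqrt t) :=
  fun _ _ hst ↦ Chebyshev.psi_mono (Real.sqrt_le_sqrt hst)

/-- The right derivative of `U(t) = R₁(√t)` is `(ψ(√t) − √t)/(2√t)` (`t > 0`). [folklore] -/
theorem hasDerivWithinAt_Rone_sqrt {t : ℝ} (ht : 0 < t) :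
    HasDerivWithinAt (fun u : ℝ ↦ Rone (Real.sqrt u))
      ((ψ (Real.sqrt t) - Real.sqrt t) * (1 / (2 * Real.sqrt t))) (Ioi t) t := by
  have h1 := hasDerivWithinAt_Rone (Real.sqrt t)
  have h2 := (Real.hasDerivAt_sqrt ht.ne').hasDerivWithinAt (s := Ioi t)
  have hmaps : MapsTo (fun u : ℝ ↦ Real.sqrt u) (Ioi t) (Ioi (Real.sqrt t)) :=
    fun u hu ↦ Real.sqrt_lt_sqrt ht.le hu
  exact h1.comp t h2 hmaps

/-- **Integration by parts**: for `1 < a ≤ X`,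
`∫ₐ^X (ψ(√t) − √t) w₀(t) dt = R₁(√X) V(X) − R₁(√a) V(a) − ∫ₐ^X R₁(√t) V'(t) dt` with
`V(t) = 2 wt(t) t^{−3/2}`, `V'(t) = −(3/log t + 5/log² t + 4/log³ t) t^{−5/2}`, `R₁ = ψ₁ − t²/2`.
[cite: Nicolas2012, Cor. 2.1 (2.13) (our averaged form of its input)] -/
theorem integral_R_sqrt_mul_w0_eq {a X : ℝ} (ha : 1 < a) (haX : a ≤ X) :
    ∫ t in a..X, (ψ (Real.sqrt t) - Real.sqrt t) * w0 t =
      Rone (Real.sqrt X) * (2 * wt X * X ^ (-(3 / 2) : ℝ)) -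
        Rone (Real.sqrt a) * (2 * wt a * a ^ (-(3 / 2) : ℝ)) -
        ∫ t in a..X, Rone (Real.sqrt t) *
          (-(3 / Real.log t + 5 / Real.log t ^ 2 + 4 / Real.log t ^ 3) * t ^ (-(5 / 2) : ℝ)) := by
  have ha0 : 0 < a := by linarith
  have hIcc : uIcc a X = Icc a X := uIcc_of_le haX
  -- continuity of `U = R₁ ∘ √` and `V`
  have hU : ContinuousOn (fun u : ℝ ↦ Rone (Real.sqrt u)) (uIcc a X) :=
    (continuous_Rone.comp Real.continuous_sqrt).continuousOn
  have hV : ContinuousOn (fun t : ℝ ↦ 2 * wt t * t ^ (-(3 / 2) : ℝ)) (uIcc a X) := by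
    rw [hIcc]; exact (continuousOn_V ha).mono Icc_subset_Ici_self
  -- right derivatives inside
  have hUU' : ∀ t ∈ Ioo (min a X) (max a X), HasDerivWithinAt (fun u : ℝ ↦ Rone (Real.sqrt u))
      ((ψ (Real.sqrt t) - Real.sqrt t) * (1 / (2 * Real.sqrt t))) (Ioi t) t := by
    intro t ht
    rw [min_eq_left haX] at ht
    exact hasDerivWithinAt_Rone_sqrt (ha0.trans ht.1)
  have hVV' : ∀ t ∈ Ioo (min a X) (max a X), HasDerivWithinAt (fun u : ℝ ↦ 2 * wt u * u ^ (-(3 / 2) : ℝ))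
      (-(3 / Real.log t + 5 / Real.log t ^ 2 + 4 / Real.log t ^ 3) * t ^ (-(5 / 2) : ℝ)) (Ioi t) t := by
    intro t ht
    rw [min_eq_left haX] at ht
    exact (hasDerivAt_V (ha.trans ht.1)).hasDerivWithinAt
  -- integrability of `U'` and `V'`
  have hsqrtC : ContinuousOn (fun t : ℝ ↦ 1 / (2 * Real.sqrt t)) (uIcc a X) := by
    refine continuousOn_const.div (continuousOn_const.mul Real.continuous_sqrt.continuousOn) fun t ht ↦ ?_
    rw [hIcc] at ht
    have : 0 < Real.sqrt t := Real.sqrt_pos.2 (ha0.trans_le ht.1)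
    positivity
  have hU' : IntervalIntegrable (fun t : ℝ ↦ (ψ (Real.sqrt t) - Real.sqrt t) * (1 / (2 * Real.sqrt t)))
      volume a X :=
    (monotone_psi_sqrt.intervalIntegrable.sub (Real.continuous_sqrt.intervalIntegrable _ _)).mul_continuousOn hsqrtC
  have hV'c : ContinuousOn (fun t : ℝ ↦ -(3 / Real.log t + 5 / Real.log t ^ 2 + 4 / Real.log t ^ 3) *
      t ^ (-(5 / 2) : ℝ)) (uIcc a X) := by
    rw [hIcc]; exact (continuousOn_V' ha).mono Icc_subset_Ici_self
  have hV' : IntervalIntegrable (fun t : ℝ ↦ -(3 / Real.log t + 5 / Real.log t ^ 2 + 4 / Real.log t ^ 3) *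
      t ^ (-(5 / 2) : ℝ)) volume a X := hV'c.intervalIntegrable
  have h := integral_deriv_mul_eq_sub_of_hasDeriv_right hU hV hUU' hVV' hU' hV'
  -- split the integral of the sum
  have hi1 : IntervalIntegrable (fun t : ℝ ↦ (ψ (Real.sqrt t) - Real.sqrt t) * (1 / (2 * Real.sqrt t)) *
      (2 * wt t * t ^ (-(3 / 2) : ℝ))) volume a X := hU'.mul_continuousOn hV
  have hi2 : IntervalIntegrable (fun t : ℝ ↦ Rone (Real.sqrt t) *
      (-(3 / Real.log t + 5 / Real.log t ^ 2 + 4 / Real.log t ^ 3) * t ^ (-(5 / 2) : ℝ))) volume a X :=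
    hV'.continuousOn_mul hU
  rw [intervalIntegral.integral_add hi1 hi2] at h
  -- `U'V = (ψ(√t) − √t) w₀`
  have hUV : ∫ t in a..X, (ψ (Real.sqrt t) - Real.sqrt t) * (1 / (2 * Real.sqrt t)) *
      (2 * wt t * t ^ (-(3 / 2) : ℝ)) = ∫ t in a..X, (ψ (Real.sqrt t) - Real.sqrt t) * w0 t := by
    refine intervalIntegral.integral_congr fun t ht ↦ ?_
    rw [hIcc] at ht
    have ht0 : 0 < t := ha0.trans_le ht.1
    rw [mul_assoc, uv_eq_w0 ht0]
  rw [hUV] at h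
  linarith

/-! ### `R₁` through the explicit formula: real parts -/

/-- **`R₁(u) = −Re Z(u) − u log 2π + Re E(u)`** for `u ≥ 1` (real part of the explicit formula
`NicolasJExplicit.Rone_eq_explicit`). [cite: MontgomeryVaughan2007, (13.7)] -/
theorem Rone_eq_re {u : ℝ} (hu : 1 ≤ u) :
    Rone u = -(Zsum u).re - u * Real.log (2 * π) + (psiOneRemainder u).re := by
  have h := congrArg Complex.re (Rone_eq_explicit hu)
  rw [log_two_pi] at h
  simpa [Complex.ofReal_re, Complex.sub_re, Complex.add_re, Complex.neg_re, ← Complex.ofReal_mul] using h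

/-- Under RH, `|Re Z(u)| ≤ β u^{3/2}` (`u ≥ 1`). [cite: MontgomeryVaughan2007, §13.1 (13.8)] -/
theorem abs_Zsum_re_le (hRH : RiemannHypothesis) {u : ℝ} (hu : 1 ≤ u) :
    |(Zsum u).re| ≤ nicolasBeta * u ^ (3 / 2 : ℝ) := by
  have h1 : ‖Zsum u‖ ≤ nicolasBeta * u ^ (3 / 2 : ℝ) := norm_psiOne_zeroSum_le_of_RH hRH hu
  exact (Complex.abs_re_le_norm _).trans h1

/-- Under RH, `R₁(√t) ≤ β t^{3/4} + Re E(√t)` for `t ≥ 1` (the linear term `−√t log 2π` is dropped).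
[cite: MontgomeryVaughan2007, §13.1 (13.8)] -/
theorem Rone_sqrt_le (hRH : RiemannHypothesis) {t : ℝ} (ht : 1 ≤ t) :
    Rone (Real.sqrt t) ≤ nicolasBeta * t ^ (3 / 4 : ℝ) + (psiOneRemainder (Real.sqrt t)).re := by
  have ht0 : 0 ≤ t := by linarith
  have hs1 : 1 ≤ Real.sqrt t := by
    rw [show (1 : ℝ) = Real.sqrt 1 by simp]; exact Real.sqrt_le_sqrt ht
  have h := abs_Zsum_re_le hRH hs1
  rw [sqrt_rpow_three_halves ht0] at h
  have hlog : 0 ≤ Real.log (2 * π) := Real.log_nonneg (by linarith [Real.pi_gt_three])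
  have hs0 : 0 ≤ Real.sqrt t := Real.sqrt_nonneg t
  rw [Rone_eq_re hs1]
  have := (abs_le.1 h).1
  nlinarith [mul_nonneg hs0 hlog]

/-- Under RH, `−R₁(√a) ≤ β a^{3/4} + √a log 2π − Re E(√a)` for `a ≥ 1`.
[cite: MontgomeryVaughan2007, §13.1 (13.8)] -/
theorem neg_Rone_sqrt_le (hRH : RiemannHypothesis) {a : ℝ} (ha : 1 ≤ a) :
    -Rone (Real.sqrt a) ≤ nicolasBeta * a ^ (3 / 4 : ℝ) + Real.sqrt a * Real.log (2 * π) -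
      (psiOneRemainder (Real.sqrt a)).re := by
  have ha0 : 0 ≤ a := by linarith
  have hs1 : 1 ≤ Real.sqrt a := by
    rw [show (1 : ℝ) = Real.sqrt 1 by simp]; exact Real.sqrt_le_sqrt ha
  have h := abs_Zsum_re_le hRH hs1
  rw [sqrt_rpow_three_halves ha0] at h
  rw [Rone_eq_re hs1]
  have := (abs_le.1 h).2
  linarith

/-! ### The bound -/

/-- **The averaged square-root term under RH**: for `1 < a ≤ X`,
`∫ₐ^X (ψ(√t) − √t) w₀(t) dt ≤ 2β wt(a) a^{−3/4} + (4/3) β h(a) a^{−3/4} + 2 log(2π) wt(a) a⁻¹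
 + wt(a) a⁻¹/(a − 1) + 2β wt(a) X^{−3/4}` (`wt = 1/log + 1/log²`, `h = 3/log + 5/log² + 4/log³`,
`β = nicolasBeta`). Integration by parts (`integral_R_sqrt_mul_w0_eq`), the explicit formula for
`ψ₁` under RH (`|Z| ≤ β u^{3/2}`), and the monotone trivial-zero remainder
(`TrivialZerosSimple.re_psiOneRemainder_sub_mem`); the last term tends to `0` with `X`.
[cite: Nicolas2012, Cor. 2.1 (2.13) (averaged input, replacing Lemma 2.4 Case 2)] -/
theorem integral_R_sqrt_mul_w0_le (hRH : RiemannHypothesis) {a X : ℝ} (ha : 1 < a) (haX : a ≤ X) :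
    ∫ t in a..X, (ψ (Real.sqrt t) - Real.sqrt t) * w0 t ≤
      2 * nicolasBeta * wt a * a ^ (-(3 / 4) : ℝ)
      + 4 / 3 * nicolasBeta * (3 / Real.log a + 5 / Real.log a ^ 2 + 4 / Real.log a ^ 3) * a ^ (-(3 / 4) : ℝ)
      + 2 * Real.log (2 * π) * wt a * a⁻¹ + wt a * (a⁻¹ / (a - 1))
      + 2 * nicolasBeta * wt a * X ^ (-(3 / 4) : ℝ) := by
  have ha0 : 0 < a := by linarith
  have hX1 : 1 < X := ha.trans_le haX
  have hX0 : 0 < X := ha0.trans_le haX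
  have hβ : 0 < nicolasBeta := lt_trans (by norm_num) nicolasBeta_gt
  have hlog2π : 0 ≤ Real.log (2 * π) := Real.log_nonneg (by linarith [Real.pi_gt_three])
  have hIcc : uIcc a X = Icc a X := uIcc_of_le haX
  have hha : 0 < 3 / Real.log a + 5 / Real.log a ^ 2 + 4 / Real.log a ^ 3 := h_pos ha
  have hwta : 0 < wt a := by have := Real.log_pos ha; unfold wt; positivity
  have hwtX : 0 < wt X := by have := Real.log_pos (ha.trans_le haX); unfold wt; positivity
  -- square roots
  have hsa1 : 1 < Real.sqrt a := (Real.lt_sqrt zero_le_one).2 (by simpa using ha)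
  have hsaX : Real.sqrt a ≤ Real.sqrt X := Real.sqrt_le_sqrt haX
  -- Step 1: integration by parts; name the atoms
  rw [integral_R_sqrt_mul_w0_eq ha haX]
  set Va : ℝ := 2 * wt a * a ^ (-(3 / 2) : ℝ) with hVa
  set VX : ℝ := 2 * wt X * X ^ (-(3 / 2) : ℝ) with hVX
  set pa : ℝ := a ^ (-(3 / 4) : ℝ) with hpa
  set pX : ℝ := X ^ (-(3 / 4) : ℝ) with hpX
  have hVa0 : 0 ≤ Va := by positivity
  have hVX0 : 0 ≤ VX := by positivity
  have hpX0 : 0 < pX := Real.rpow_pos_of_pos hX0 _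
  -- Step 2: the boundary terms
  have eA1 : nicolasBeta * a ^ (3 / 4 : ℝ) * Va = 2 * nicolasBeta * wt a * pa := by
    rw [hVa, hpa, show nicolasBeta * a ^ (3 / 4 : ℝ) * (2 * wt a * a ^ (-(3 / 2) : ℝ)) =
      2 * nicolasBeta * wt a * (a ^ (3 / 4 : ℝ) * a ^ (-(3 / 2) : ℝ)) by ring, rpow_three_quarters_mul' ha0]
  have eA2 : Real.sqrt a * Real.log (2 * π) * Va = 2 * Real.log (2 * π) * wt a * a⁻¹ := by
    rw [hVa, show Real.sqrt a * Real.log (2 * π) * (2 * wt a * a ^ (-(3 / 2) : ℝ)) =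
      2 * Real.log (2 * π) * wt a * (Real.sqrt a * a ^ (-(3 / 2) : ℝ)) by ring,
      sqrt_mul_rpow_neg_three_halves ha0]
  have eA3 : Real.sqrt a / (2 * (a - 1)) * Va = wt a * (a⁻¹ / (a - 1)) := by
    have ha1 : a - 1 ≠ 0 := by linarith
    rw [hVa, ← sqrt_mul_rpow_neg_three_halves ha0]
    field_simp
  have eX1 : nicolasBeta * X ^ (3 / 4 : ℝ) * VX = 2 * nicolasBeta * wt X * pX := by
    rw [hVX, hpX, show nicolasBeta * X ^ (3 / 4 : ℝ) * (2 * wt X * X ^ (-(3 / 2) : ℝ)) =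
      2 * nicolasBeta * wt X * (X ^ (3 / 4 : ℝ) * X ^ (-(3 / 2) : ℝ)) by ring, rpow_three_quarters_mul' hX0]
  have hXterm : 2 * nicolasBeta * wt X * pX ≤ 2 * nicolasBeta * wt a * pX := by
    have h := mul_le_mul_of_nonneg_left (wt_le ha haX) (by positivity : (0 : ℝ) ≤ 2 * nicolasBeta * pX)
    linarith
  have hT1 : Rone (Real.sqrt X) * VX ≤
      2 * nicolasBeta * wt a * pX + (psiOneRemainder (Real.sqrt X)).re * VX := by
    have h1 : Rone (Real.sqrt X) * VX ≤
        (nicolasBeta * X ^ (3 / 4 : ℝ) + (psiOneRemainder (Real.sqrt X)).re) * VX :=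
      mul_le_mul_of_nonneg_right (Rone_sqrt_le hRH hX1.le) hVX0
    linarith [h1, eX1, hXterm]
  have hT2 : -(Rone (Real.sqrt a) * Va) ≤ 2 * nicolasBeta * wt a * pa +
      2 * Real.log (2 * π) * wt a * a⁻¹ - (psiOneRemainder (Real.sqrt a)).re * Va := by
    have h1 : -Rone (Real.sqrt a) * Va ≤ (nicolasBeta * a ^ (3 / 4 : ℝ) + Real.sqrt a * Real.log (2 * π) -
        (psiOneRemainder (Real.sqrt a)).re) * Va :=
      mul_le_mul_of_nonneg_right (neg_Rone_sqrt_le hRH ha.le) hVa0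
    linarith [h1, eA1, eA2]
  -- Step 3: the integral term, pointwise on `[a, X]`
  have hpt : ∀ t ∈ Icc a X,
      -(nicolasBeta * (3 / Real.log a + 5 / Real.log a ^ 2 + 4 / Real.log a ^ 3) * t ^ (-(7 / 4) : ℝ) +
        (psiOneRemainder (Real.sqrt X)).re *
          ((3 / Real.log t + 5 / Real.log t ^ 2 + 4 / Real.log t ^ 3) * t ^ (-(5 / 2) : ℝ))) ≤
      Rone (Real.sqrt t) *
        (-(3 / Real.log t + 5 / Real.log t ^ 2 + 4 / Real.log t ^ 3) * t ^ (-(5 / 2) : ℝ)) := by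
    intro t ht
    have ht1 : 1 < t := ha.trans_le ht.1
    have ht0 : 0 < t := by linarith
    have hht : 0 < 3 / Real.log t + 5 / Real.log t ^ 2 + 4 / Real.log t ^ 3 := h_pos ht1
    have hhta := h_le ha ht.1
    have h52 : 0 < t ^ (-(5 / 2) : ℝ) := Real.rpow_pos_of_pos ht0 _
    have h74 : 0 ≤ t ^ (-(7 / 4) : ℝ) := (Real.rpow_pos_of_pos ht0 _).le
    have hw : 0 ≤ (3 / Real.log t + 5 / Real.log t ^ 2 + 4 / Real.log t ^ 3) * t ^ (-(5 / 2) : ℝ) := by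
      positivity
    have hR := Rone_sqrt_le hRH ht1.le
    have hst1 : 1 < Real.sqrt t := (Real.lt_sqrt zero_le_one).2 (by simpa using ht1)
    have hmono : (psiOneRemainder (Real.sqrt t)).re ≤ (psiOneRemainder (Real.sqrt X)).re :=
      re_psiOneRemainder_mono hst1 (Real.sqrt_le_sqrt ht.2)
    have h1 : Rone (Real.sqrt t) * ((3 / Real.log t + 5 / Real.log t ^ 2 + 4 / Real.log t ^ 3) *
        t ^ (-(5 / 2) : ℝ)) ≤ (nicolasBeta * t ^ (3 / 4 : ℝ) + (psiOneRemainder (Real.sqrt X)).re) *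
        ((3 / Real.log t + 5 / Real.log t ^ 2 + 4 / Real.log t ^ 3) * t ^ (-(5 / 2) : ℝ)) :=
      mul_le_mul_of_nonneg_right (by linarith) hw
    have h2 : nicolasBeta * t ^ (3 / 4 : ℝ) * ((3 / Real.log t + 5 / Real.log t ^ 2 + 4 / Real.log t ^ 3) *
        t ^ (-(5 / 2) : ℝ)) ≤
        nicolasBeta * (3 / Real.log a + 5 / Real.log a ^ 2 + 4 / Real.log a ^ 3) * t ^ (-(7 / 4) : ℝ) := by
      rw [show nicolasBeta * t ^ (3 / 4 : ℝ) * ((3 / Real.log t + 5 / Real.log t ^ 2 + 4 / Real.log t ^ 3) *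
          t ^ (-(5 / 2) : ℝ)) = nicolasBeta * (3 / Real.log t + 5 / Real.log t ^ 2 + 4 / Real.log t ^ 3) *
          (t ^ (3 / 4 : ℝ) * t ^ (-(5 / 2) : ℝ)) by ring, rpow_three_quarters_mul ht0]
      exact mul_le_mul_of_nonneg_right (mul_le_mul_of_nonneg_left hhta hβ.le) h74
    linarith [h1, h2]
  -- Step 3': integrate the pointwise bound
  have hrpowC : ∀ p : ℝ, ContinuousOn (fun t : ℝ ↦ t ^ p) (uIcc a X) := by
    intro p
    rw [hIcc]
    exact ContinuousOn.rpow_const continuousOn_id fun t ht ↦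
      Or.inl (ne_of_gt (show (0 : ℝ) < t by linarith [ht.1]))
  have hhC : ContinuousOn (fun t : ℝ ↦ 3 / Real.log t + 5 / Real.log t ^ 2 + 4 / Real.log t ^ 3) (uIcc a X) := by
    rw [hIcc]; exact (continuousOn_h ha).mono Icc_subset_Ici_self
  have hV'c : ContinuousOn (fun t : ℝ ↦ -(3 / Real.log t + 5 / Real.log t ^ 2 + 4 / Real.log t ^ 3) *
      t ^ (-(5 / 2) : ℝ)) (uIcc a X) := by
    rw [hIcc]; exact (continuousOn_V' ha).mono Icc_subset_Ici_self
  have hiL : IntervalIntegrable (fun t : ℝ ↦ Rone (Real.sqrt t) *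
      (-(3 / Real.log t + 5 / Real.log t ^ 2 + 4 / Real.log t ^ 3) * t ^ (-(5 / 2) : ℝ))) volume a X :=
    hV'c.intervalIntegrable.continuousOn_mul ((continuous_Rone.comp Real.continuous_sqrt).continuousOn)
  have hi1 : IntervalIntegrable (fun t : ℝ ↦
      nicolasBeta * (3 / Real.log a + 5 / Real.log a ^ 2 + 4 / Real.log a ^ 3) * t ^ (-(7 / 4) : ℝ))
      volume a X := (continuousOn_const.mul (hrpowC _)).intervalIntegrable
  have hi2 : IntervalIntegrable (fun t : ℝ ↦ (psiOneRemainder (Real.sqrt X)).re *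
      ((3 / Real.log t + 5 / Real.log t ^ 2 + 4 / Real.log t ^ 3) * t ^ (-(5 / 2) : ℝ))) volume a X :=
    (continuousOn_const.mul (hhC.mul (hrpowC _))).intervalIntegrable
  have hiR : IntervalIntegrable (fun t : ℝ ↦
      -(nicolasBeta * (3 / Real.log a + 5 / Real.log a ^ 2 + 4 / Real.log a ^ 3) * t ^ (-(7 / 4) : ℝ) +
        (psiOneRemainder (Real.sqrt X)).re *
          ((3 / Real.log t + 5 / Real.log t ^ 2 + 4 / Real.log t ^ 3) * t ^ (-(5 / 2) : ℝ)))) volume a X :=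
    (hi1.add hi2).neg
  have hint_le := intervalIntegral.integral_mono_on haX hiR hiL hpt
  -- evaluate the majorant integral
  have hI74 : ∫ t in a..X, t ^ (-(7 / 4) : ℝ) = (pX - pa) / (-(3 / 4)) := by
    have h := integral_rpow (a := a) (b := X) (r := -(7 / 4))
      (Or.inr ⟨by norm_num, by rw [hIcc]; exact fun h ↦ by linarith [h.1]⟩)
    rw [h, hpX, hpa]; norm_num
  have hIV : ∫ t in a..X, (3 / Real.log t + 5 / Real.log t ^ 2 + 4 / Real.log t ^ 3) * t ^ (-(5 / 2) : ℝ) =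
      Va - VX := integral_negV' ha haX
  have hmaj : ∫ t in a..X,
      -(nicolasBeta * (3 / Real.log a + 5 / Real.log a ^ 2 + 4 / Real.log a ^ 3) * t ^ (-(7 / 4) : ℝ) +
        (psiOneRemainder (Real.sqrt X)).re *
          ((3 / Real.log t + 5 / Real.log t ^ 2 + 4 / Real.log t ^ 3) * t ^ (-(5 / 2) : ℝ))) =
      -(nicolasBeta * (3 / Real.log a + 5 / Real.log a ^ 2 + 4 / Real.log a ^ 3) * ((pX - pa) / (-(3 / 4))) +
        (psiOneRemainder (Real.sqrt X)).re * (Va - VX)) := by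
    rw [intervalIntegral.integral_neg, intervalIntegral.integral_add hi1 hi2,
      intervalIntegral.integral_const_mul, intervalIntegral.integral_const_mul, hI74, hIV]
  rw [hmaj] at hint_le
  -- Step 4: the remainder difference
  have hE : (psiOneRemainder (Real.sqrt X)).re - (psiOneRemainder (Real.sqrt a)).re ≤
      Real.sqrt a / (2 * (a - 1)) := by
    have h := (re_psiOneRemainder_sub_mem hsa1 hsaX).2
    rw [Real.sq_sqrt ha0.le] at h
    exact h
  have hEV : ((psiOneRemainder (Real.sqrt X)).re - (psiOneRemainder (Real.sqrt a)).re) * Va ≤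
      wt a * (a⁻¹ / (a - 1)) := by
    rw [← eA3]; exact mul_le_mul_of_nonneg_right hE hVa0
  have hdrop : 0 ≤ nicolasBeta * (3 / Real.log a + 5 / Real.log a ^ 2 + 4 / Real.log a ^ 3) * pX := by
    positivity
  -- assemble
  linarith [hT1, hT2, hint_le, hEV, hdrop]

end NicolasSqrtAverage

end Literature.NumberTheory.LFunctions

end
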